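/-
Copyright (c) 2026. All rights reserved.
Released under Apache 2.0 license as described in the file LICENSE.
Authors: abc-iut cell, wave-2 seat abc-iut-L3-t11 (G31 conjunct (4): [SemiAnbd] Example 2.10, total
estrangement, reduced to the malnormality of cusp inertia in pro-Σ surface groups).
-/
import Literature.AnabelianGeometry.SemiGraphs.Commensurability
import Literature.AnabelianGeometry.SemiGraphs.BranchSubgroupLemmas
import Literature.AnabelianGeometry.SemiGraphs.Coverticial
import HarnessLib

/-!
# [SemiAnbd] Example 2.10, conjunct (4): a semi-graph of anabelioids of surface type is totally estranged

Mochizuki, *Semi-graphs of anabelioids*, Publ. RIMS **42** (2006) [MochizukiSemiAnbd2006], Example 2.10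
p. 31: a semi-graph of anabelioids of surface type "is … totally estranged [cf. the proof of [Mzk3], Lemma
1.3.7]" — typed by abc-iut-L3-t1 as a conjunct of the named fact `SemiGraphOfAnabelioids.example_2_10`
over the interface `IsOfSurfaceType Sigma` (`Coverticial.lean`), with "estranged" = the edge intersection
condition of Def. 2.4 (iv) in the REPAIRED form of `Commensurability.lean` v2 (ruling Ϡ: for `b' ≠ b` the
intersections `Π_b ∩ g·Π_{b'}·g⁻¹`, every representative, are of infinite index in `Π_b` and trivial; for
`b' = b` the same with ONE representative and `g ∉ Π_b`).

The group theory print points to ([Mzk3] = [AbsAnab] Lemma 1.3.7, proof) is recorded ONCE as the named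
fact `ProSigmaCuspInertiaMalnormal`: in the pro-`Σ` completion `P` of a hyperbolic punctured surface
group `Γ_{g,r}`, the closed cusp inertia subgroups `I_i = closure(ι(⟨c_i⟩))` are infinite, and
`I_i ∩ x·I_j·x⁻¹ = 1` unless `i = j` and `x ∈ I_i` (distinct cusps have disjoint inertia up to conjugacy;
each `I_i` is malnormal). Conjunct (4) is then PROVED (`example_2_10_totallyEstranged_of`): by
`IsOfSurfaceType.vertex` every representative `Π_b^{(Fe, α)}` of a branch subgroup at `v` is a conjugate
`t·I_{js b}·t⁻¹` (the interface pins one representative as `closure(ι(I_{js b}))`, and a change of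
transport conjugates — abc-iut-L3-t1's `branchSubgroup_eq_conjAct_smul`), the cusps `js b ≠ js b'` for
`b ≠ b'` (`js` injective), so both clauses of the condition are instances of the named fact, and
"infinite index" of the trivial intersection is the infinitude of `Π_b`.

In-tree partial evidence for the named fact: abc-iut-L5's [IUTchI] §2 chain (normal terminality
`N_{F̂}(T̂_g) = T̂_g` and the centraliser condition for PROFINITE completions of free groups,
`ProfiniteCompletionNormalizers.lean`); the pro-`Σ` malnormality itself is not in the tree.
One definition (the named fact); nothing here bears on [IUTchIII] Cor. 3.12.
-/

namespace Literature.AnabelianGeometry.SemiGraphs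

open CategoryTheory PreGaloisCategory
open Literature.GroupTheory.CombinatorialGroupTheory Literature.AlgebraicGeometry.Frobenioids
open scoped Pointwise

universe w v₁ u₁ u

/-! ### The named fact: cusp inertia in pro-`Σ` surface groups -/

/-- **Cusp inertia subgroups of pro-`Σ` surface groups are infinite, pairwise disjoint up to conjugacy,
and malnormal** ([AbsAnab] = [Mzk3] Lemma 1.3.7, proof; the fact [SemiAnbd] Ex. 2.10 p. 31 invokes for
"totally estranged"): for a nonempty set of primes `Σ`, a hyperbolic type `(g, r)`, and a pro-`Σ`
completion `ι : Γ_{g,r} → P` into a profinite group, the closures `I_i` of the images of the cusp inertia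
groups `⟨c_i⟩ ⊆ Γ_{g,r}` satisfy: `I_i` is infinite, and `I_i ∩ x·I_j·x⁻¹ = 1` whenever `i ≠ j` or
`x ∉ I_i`. Named fact, not proved here. [cite: MochizukiAbsAnab2004, Lemma 1.3.7 p.18] -/
def ProSigmaCuspInertiaMalnormal : Prop :=
  ∀ (Sigma : Set ℕ), Sigma.Nonempty → (∀ p ∈ Sigma, p.Prime) →
    ∀ (g r : ℕ), PuncturedSurfaceGroup.IsHyperbolicType g r →
      ∀ (P : Type w) [Group P] [TopologicalSpace P] [IsTopologicalGroup P] [CompactSpace P]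
        [T2Space P] [TotallyDisconnectedSpace P] (ι : PuncturedSurfaceGroup g r →* P),
        SemiGraphOfAnabelioids.IsProSigmaCompletion Sigma ι →
          ∀ i j : Fin r,
            Infinite ((PuncturedSurfaceGroup.cuspInertia (g := g) i).map ι).topologicalClosure ∧
            ∀ x : P, (i ≠ j ∨ x ∉ ((PuncturedSurfaceGroup.cuspInertia (g := g) i).map ι).topologicalClosure) →
              ((PuncturedSurfaceGroup.cuspInertia (g := g) i).map ι).topologicalClosure ⊓
                ConjAct.toConjAct x • ((PuncturedSurfaceGroup.cuspInertia (g := g) j).map ι).topologicalClosure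
                = ⊥

/-! ### Two pointwise-conjugation lemmas -/

section Conj

variable {G : Type*} [Group G]

/-- If `A ∩ (t⁻¹ s)·B·(t⁻¹ s)⁻¹ = 1` then `t·A·t⁻¹ ∩ s·B·s⁻¹ = 1`. [folklore] -/
private theorem smul_inf_smul_eq_bot {A B : Subgroup G} {t s : ConjAct G}
    (h : A ⊓ (t⁻¹ * s) • B = ⊥) : t • A ⊓ s • B = ⊥ := by
  rw [eq_bot_iff]
  rintro x ⟨hxA, hxB⟩
  have h1 : t⁻¹ • x ∈ A := Subgroup.mem_pointwise_smul_iff_inv_smul_mem.mp hxA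
  have h2 : t⁻¹ • x ∈ (t⁻¹ * s) • B := by
    rw [mul_smul]
    exact Subgroup.smul_mem_pointwise_smul x t⁻¹ (s • B) hxB
  have h3 : t⁻¹ • x ∈ A ⊓ (t⁻¹ * s) • B := ⟨h1, h2⟩
  rw [h] at h3
  have h4 : t⁻¹ • x = 1 := (Subgroup.mem_bot).mp h3
  rw [Subgroup.mem_bot, ← smul_inv_smul t x, h4, smul_one]

/-- `x ∉ t·A·t⁻¹ ↔ t⁻¹·x·t ∉ A`, i.e. `ofConjAct (t⁻¹ * toConjAct x * t) ∉ A`. [folklore] -/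
private theorem not_mem_smul_iff {A : Subgroup G} {t : ConjAct G} {x : G} :
    x ∉ t • A ↔ ConjAct.ofConjAct (t⁻¹ * ConjAct.toConjAct x * t) ∉ A := by
  rw [Subgroup.mem_pointwise_smul_iff_inv_smul_mem, ConjAct.smul_def]
  simp [mul_assoc]

end Conj

namespace SemiGraphOfAnabelioids

variable (𝒢 : SemiGraphOfAnabelioids.{v₁, u₁, u})

/-- A set-level identification of a branch subgroup with the closure of the image of a cusp inertia group
upgrades to an equality of subgroups with the topological closure of the mapped subgroup.
[cite: MochizukiSemiAnbd2006, Ex. 2.10 p.31] -/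
theorem branchSubgroup_eq_topologicalClosure {v : 𝒢.graph.Vertex} (F : 𝒢.V v ⥤ FintypeCat.{v₁})
    [FiberFunctor F] {b : 𝒢.graph.Branch} (h : 𝒢.graph.abuts b = some v)
    (Fe : 𝒢.E (𝒢.graph.edgeOf b) ⥤ FintypeCat.{v₁}) (α : (𝒢.pull b v h).pullback ⋙ Fe ≅ F)
    {Γ : Type*} [Group Γ] (ι : Γ →* Aut F) (S : Subgroup Γ)
    (hS : (𝒢.branchSubgroup F b h Fe α : Set (Aut F)) = closure (ι '' (S : Set Γ))) :
    𝒢.branchSubgroup F b h Fe α = (S.map ι).topologicalClosure := by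
  apply SetLike.coe_injective
  rw [hS, Subgroup.topologicalClosure_coe, Subgroup.coe_map]

/-- **Every fibre-functor representative of a branch subgroup at a surface-type vertex is a conjugate of a
closed cusp inertia subgroup**: with the surface structure `(g, r, ι, js)` of `IsOfSurfaceType.vertex` at
`(v, F)`, for every branch `b` at `v`, every basepoint `Fe` of `𝒢_e` and every transport `α`,
`Π_b^{(Fe, α)} = t · closure(ι(I_{js b})) · t⁻¹` for some `t ∈ Π_v` (the interface pins one transport;
abc-iut-L3-t1's `branchSubgroup_eq_conjAct_smul` moves it). [cite: MochizukiSemiAnbd2006, Ex. 2.10 p.31] -/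
theorem exists_branchSubgroup_eq_smul_of_vertexData {v : 𝒢.graph.Vertex} (F : 𝒢.V v ⥤ FintypeCat.{v₁})
    [FiberFunctor F] {g r : ℕ} (ι : PuncturedSurfaceGroup g r →* Aut F)
    (js : {b : 𝒢.graph.Branch // 𝒢.graph.abuts b = some v} → Fin r)
    (hbr : ∀ (b : {b : 𝒢.graph.Branch // 𝒢.graph.abuts b = some v})
      (Fe : 𝒢.E (𝒢.graph.edgeOf b.1) ⥤ FintypeCat.{v₁}) [FiberFunctor Fe],
      ∃ α : (𝒢.pull b.1 v b.2).pullback ⋙ Fe ≅ F,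
        (𝒢.branchSubgroup F b.1 b.2 Fe α : Set (Aut F)) =
          closure (ι '' ((PuncturedSurfaceGroup.cuspInertia (g := g) (js b) :
            Subgroup (PuncturedSurfaceGroup g r)) : Set (PuncturedSurfaceGroup g r))))
    (b : 𝒢.graph.Branch) (h : 𝒢.graph.abuts b = some v)
    (Fe : 𝒢.E (𝒢.graph.edgeOf b) ⥤ FintypeCat.{v₁}) [FiberFunctor Fe]
    (α : (𝒢.pull b v h).pullback ⋙ Fe ≅ F) :
    ∃ t : ConjAct (Aut F), 𝒢.branchSubgroup F b h Fe α =
      t • ((PuncturedSurfaceGroup.cuspInertia (g := g) (js ⟨b, h⟩)).map ι).topologicalClosure := by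
  obtain ⟨α₀, hα₀⟩ := hbr ⟨b, h⟩ Fe
  refine ⟨ConjAct.toConjAct (transportAut α₀ α), ?_⟩
  rw [branchSubgroup_eq_conjAct_smul 𝒢 F b h Fe α₀ α,
    𝒢.branchSubgroup_eq_topologicalClosure F h Fe α₀ ι _ hα₀]

/-- **[SemiAnbd] Example 2.10, conjunct (4), the `b' ≠ b` clause, PROVED from
`ProSigmaCuspInertiaMalnormal` for fibre-functor representatives**: at a vertex of a semi-graph of
anabelioids of surface type, for branches `b ≠ b'` at `v`, basepoints `F`, `Fe`, `Fe'`, transports `α`,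
`α'` and every `g ∈ Π_v`, the intersection `Π_b ∩ g·Π_{b'}·g⁻¹` is TRIVIAL and of infinite index in `Π_b`
(distinct branches carry distinct cusps, `js` injective). [cite: MochizukiSemiAnbd2006, Ex. 2.10 p.31] -/
theorem branchSubgroup_inf_smul_eq_bot_of_ne (hM : ProSigmaCuspInertiaMalnormal.{max u₁ v₁})
    {Sigma : Set ℕ} (hS : 𝒢.IsOfSurfaceType Sigma) {v : 𝒢.graph.Vertex}
    (F : 𝒢.V v ⥤ FintypeCat.{v₁}) [FiberFunctor F]
    {b : 𝒢.graph.Branch} (h : 𝒢.graph.abuts b = some v)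
    (Fe : 𝒢.E (𝒢.graph.edgeOf b) ⥤ FintypeCat.{v₁}) [FiberFunctor Fe]
    (α : (𝒢.pull b v h).pullback ⋙ Fe ≅ F)
    {b' : 𝒢.graph.Branch} (h' : 𝒢.graph.abuts b' = some v)
    (Fe' : 𝒢.E (𝒢.graph.edgeOf b') ⥤ FintypeCat.{v₁}) [FiberFunctor Fe']
    (α' : (𝒢.pull b' v h').pullback ⋙ Fe' ≅ F) (x : Aut F) (hne : b' ≠ b) :
    (𝒢.branchSubgroup F b h Fe α ⊓ ConjAct.toConjAct x • 𝒢.branchSubgroup F b' h' Fe' α').relIndex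
        (𝒢.branchSubgroup F b h Fe α) = 0 ∧
      𝒢.branchSubgroup F b h Fe α ⊓ ConjAct.toConjAct x • 𝒢.branchSubgroup F b' h' Fe' α' = ⊥ := by
  obtain ⟨g, r, ι, hhyp, hpro, js, hjs, hbr⟩ := hS.vertex v F
  have hfact := hM Sigma hS.sigma_primes.1 hS.sigma_primes.2 g r hhyp (Aut F) ι hpro
  obtain ⟨t, ht⟩ := 𝒢.exists_branchSubgroup_eq_smul_of_vertexData F ι js hbr b h Fe α
  obtain ⟨t', ht'⟩ := 𝒢.exists_branchSubgroup_eq_smul_of_vertexData F ι js hbr b' h' Fe' α'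
  have hij : js ⟨b, h⟩ ≠ js ⟨b', h'⟩ := fun heq =>
    hne (congrArg Subtype.val (hjs heq)).symm
  have hbot : 𝒢.branchSubgroup F b h Fe α ⊓
      ConjAct.toConjAct x • 𝒢.branchSubgroup F b' h' Fe' α' = ⊥ := by
    rw [ht, ht', smul_smul]
    exact smul_inf_smul_eq_bot ((hfact _ _).2 _ (Or.inl hij))
  refine ⟨?_, hbot⟩
  rw [hbot, Subgroup.relIndex_bot_left, ht]
  haveI := (hfact (js ⟨b, h⟩) (js ⟨b, h⟩)).1
  haveI : Infinite (t • ((PuncturedSurfaceGroup.cuspInertia (g := g) (js ⟨b, h⟩)).map ι).topologicalClosure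
      : Subgroup (Aut F)) := Infinite.of_injective _ (Subgroup.equivSMul t _).injective
  exact Nat.card_eq_zero_of_infinite

/-- **[SemiAnbd] Example 2.10, conjunct (4), the `b' = b` clause, PROVED from
`ProSigmaCuspInertiaMalnormal` for fibre-functor representatives**: for `g ∉ Π_b`, the intersection
`Π_b ∩ g·Π_b·g⁻¹` is trivial and of infinite index in `Π_b` (malnormality of cusp inertia).
[cite: MochizukiSemiAnbd2006, Ex. 2.10 p.31] -/
theorem branchSubgroup_inf_smul_self_eq_bot (hM : ProSigmaCuspInertiaMalnormal.{max u₁ v₁})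
    {Sigma : Set ℕ} (hS : 𝒢.IsOfSurfaceType Sigma) {v : 𝒢.graph.Vertex}
    (F : 𝒢.V v ⥤ FintypeCat.{v₁}) [FiberFunctor F]
    {b : 𝒢.graph.Branch} (h : 𝒢.graph.abuts b = some v)
    (Fe : 𝒢.E (𝒢.graph.edgeOf b) ⥤ FintypeCat.{v₁}) [FiberFunctor Fe]
    (α : (𝒢.pull b v h).pullback ⋙ Fe ≅ F) (x : Aut F) (hx : x ∉ 𝒢.branchSubgroup F b h Fe α) :
    (𝒢.branchSubgroup F b h Fe α ⊓ ConjAct.toConjAct x • 𝒢.branchSubgroup F b h Fe α).relIndex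
        (𝒢.branchSubgroup F b h Fe α) = 0 ∧
      𝒢.branchSubgroup F b h Fe α ⊓ ConjAct.toConjAct x • 𝒢.branchSubgroup F b h Fe α = ⊥ := by
  obtain ⟨g, r, ι, hhyp, hpro, js, hjs, hbr⟩ := hS.vertex v F
  have hfact := hM Sigma hS.sigma_primes.1 hS.sigma_primes.2 g r hhyp (Aut F) ι hpro
  obtain ⟨t, ht⟩ := 𝒢.exists_branchSubgroup_eq_smul_of_vertexData F ι js hbr b h Fe α
  have hx' : ConjAct.ofConjAct (t⁻¹ * ConjAct.toConjAct x * t) ∉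
      ((PuncturedSurfaceGroup.cuspInertia (g := g) (js ⟨b, h⟩)).map ι).topologicalClosure := by
    rw [ht] at hx
    exact not_mem_smul_iff.mp hx
  have key := (hfact (js ⟨b, h⟩) (js ⟨b, h⟩)).2
    (ConjAct.ofConjAct (t⁻¹ * ConjAct.toConjAct x * t)) (Or.inr hx')
  rw [ConjAct.toConjAct_ofConjAct, mul_assoc] at key
  have hbot : 𝒢.branchSubgroup F b h Fe α ⊓
      ConjAct.toConjAct x • 𝒢.branchSubgroup F b h Fe α = ⊥ := by
    rw [ht, smul_smul]
    exact smul_inf_smul_eq_bot key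
  refine ⟨?_, hbot⟩
  rw [hbot, Subgroup.relIndex_bot_left, ht]
  haveI := (hfact (js ⟨b, h⟩) (js ⟨b, h⟩)).1
  haveI : Infinite (t • ((PuncturedSurfaceGroup.cuspInertia (g := g) (js ⟨b, h⟩)).map ι).topologicalClosure
      : Subgroup (Aut F)) := Infinite.of_injective _ (Subgroup.equivSMul t _).injective
  exact Nat.card_eq_zero_of_infinite

end SemiGraphOfAnabelioids

end Literature.AnabelianGeometry.SemiGraphs
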